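import Literature.Analysis.FluidPDE.RescaledEulerLerayMonodromy
import Literature.Analysis.FunctionSpaces.TestPairingLimits
import HarnessLib

/-!
# The period map (monodromy) of the Euler equations linearised at a time-periodic flow
  (vorticity form; the `ε = 0` end of the rescaled Euler–Leray family)

Definition request `defn-IsEulerMonodromyAt` of route `EulerMelnikovDss` (summit
NavierStokesRegularity; planner route-repair of crux #3 `FiniteMelnikovCokernel`, stmt-1467: the
`ε → 0⁺` identification clause and the `ε = 0` "tame cokernel" variant), with the conventions of
the accepted `HyperbolicDSSOrbit` / `RescaledEulerLerayMonodromy`: time-first fields on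
`ℝ³ = EuclideanSpace ℝ (Fin 3)`, solenoidal spaces `X_w = divFreeL2 w` (flat weight `w = 1` for the
short name), the pseudovector twist `pseudovectorPush`, and "monodromy = bounded operator on
`L²(w dy)` living on `X_w`, given as DATA constrained by the weak solutions it must reproduce".

## Contents

* `eulerVorticityPairing W Ω ω φ = ∫ ⟪W × ω, curl φ⟫ + ∫ ⟪BS[ω] × Ω, curl φ⟫` — the right-hand side
  of the INVISCID linearised vorticity equation `∂_σ ω = curl (W × ω) + curl (BS[ω] × Ω)` paired
  with a time-independent test field: the accepted `linVorticityPairing` minus its first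
  (Ornstein–Uhlenbeck) integral (`linVorticityPairing_eq_add_eulerVorticityPairing`, definitional).
* `IsLinearisedEulerVorticitySolution W Ω a b ω` — the `ε = 0` twin of the accepted
  `IsLinearisedVorticitySolution`: the same clauses (jointly continuous, slices in `L²(dy)`
  uniformly on `[a, b]`, weakly divergence free, absolutely convergent Biot–Savart integrals with
  locally integrable velocity) and the inviscid equation in semi-weak form on `(a, b)`.
* `IsEulerMonodromyAt w W P Q M` — VERBATIM `IsLinearisedMonodromyAt` with the solution class
  replaced by the inviscid one at background `(W, curl W)`: `M` maps `X_w` into itself, vanishes on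
  `X_wᗮ`, and `M [ω(0)] = [π̃(Q⁻¹) ω(P)]` for every inviscid weak solution on `[0, P]` whose initial
  slice defines an element of `X_w`; short name `IsEulerMonodromy := IsEulerMonodromyAt 1`
  (`L²_σ(ℝ³, dy)`, the space of the repaired crux).
* Proved API mirroring the companions (`zero`, `smul`, `continuous_pairing`;
  `apply_eq_of_solution`, `eq_of_eqOn_divFreeL2`, `unique_of_dense`, `zero_of_forall`) and a
  NON-VACUITY theorem `isEulerMonodromyAt_zero_starProjection`: at the zero seed every inviscid
  weak solution has `ω(P) = ω(0)` a.e. (`IsLinearisedEulerVorticitySolution.ae_eq_of_zero`: zero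
  derivative of the pairings, mean value theorem, du Bois-Reymond for vector fields), so for every
  weight, every `P ≥ 0` and the trivial twist the orthogonal projection onto `X_w` IS an Euler
  monodromy.

## Design notes (what is and is not asserted)

* **The object.** For a seed `W` that is `P`-periodic modulo `Q` (`W (σ + P) (Q y) = Q (W σ y)`,
  crux `PeriodicEulerSeed`), `IsEulerMonodromy W P Q M₀` says that `M₀` is the linear period map of
  the Euler equations linearised at `W` (Kielhöfer 2012, §I.12: "any solution of the variational
  equation is given by `y(t) = U(t)y₀` … `U(p)` is, by definition, its linear period map … The
  eigenvalues of the period map `U(p)` are called the Floquet multipliers"), written for the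
  vorticity — Majda–Bertozzi, §2.4.4, Prop. 2.21, eq. (2.109) with `ν = 0`: `Dω/Dt = ω·∇v`,
  `v = K₃ ∗ ω` (Biot–Savart, (2.94)); for solenoidal `v, ω` this is `∂ₜω = curl (v × ω)`, whose
  linearisation at `(W, Ω = curl W)` is `∂_σ ω = curl (W × ω) + curl (BS[ω] × Ω)` — and composed with
  `π̃(Q⁻¹)` exactly as in `IsLinearisedMonodromyAt` (the orbit tangent `∂_σ Ω` is then reproduced
  with multiplier `1`).
* **The `ε = 0` end of the family.** `IsRescaledEulerLerayMonodromyW w ε W₀ P Q` reads the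
  `ε`-linearisation `∂_σ ω = ε(Δ − ½ y·∇ − 1) ω + curl (W₀ × ω) + curl (BS[ω] × curl W₀)` through the
  rescaling `τ = εσ`, `U₀ = ε⁻¹ W₀(·/ε)`, which degenerates at `ε = 0` (period `0`, background
  `0⁻¹ • W₀`): junk there, by its own docstring. This file is the honest `ε = 0` member: the same
  pairing with the Ornstein–Uhlenbeck integral `∫ ⟪ω, Δφ + ½ Dφ[y] + ½ φ⟫` deleted, the same
  solution-class clauses, the same monodromy interface.
* **NOT asserted** (recorded for the planner; nothing of it enters the definitions): existence or
  uniqueness of `M₀` (it is DATA, pinned down on the closure of the solvable data by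
  `unique_of_dense`; on `L²_σ(dy)` and for smooth seeds with rapidly decaying vorticity an energy
  estimate is expected to give a bounded period map); that the multiplier `1` carries the symmetry
  modes (`∂_σ Ω` — Kielhöfer, loc. cit.: "`U(p)y(0) = y(p) = y(0)`, so that `1` is an eigenvalue" —,
  infinitesimal isometries compatible with `Q`, scaling) and, on the adjoint side, the `L²`-gradients
  of the Euler invariants; and the route's recorded "why it might fail", that by the
  essential-spectrum theory of linearised Euler at steady flows (Friedlander–Vishik 1991, Vishik 1996:
  the essential spectral radius of the linearised evolution is `e^{tΛ}`, `Λ` the maximal Lyapunov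
  exponent of the bicharacteristic–amplitude system; Shvydkoy 2006) the multiplier `1` should not be
  isolated. Accordingly NO Floquet multiplicity is attached to `M₀` (Kato's `algebraicMultiplicity`
  would be `⊤` in that scenario); this file says nothing about the spectrum of `M₀`.
* **Degenerate parameters**, as for the companions: `P < 0` is junk (the interval clauses are
  vacuous, so every jointly continuous field would have to be propagated); users take `0 < P`. The
  non-vacuity theorem covers `0 ≤ P`.

## References

* H. Kielhöfer, *Bifurcation Theory*, 2nd ed. (Springer 2012), §I.12, pp. 82–83 (linear period map,
  Floquet multipliers, the multiplier `1` of `dx/dt`). [Kielhofer2012]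
* A. J. Majda, A. L. Bertozzi, *Vorticity and Incompressible Flow* (CUP 2002), §2.4.4, Prop. 2.21,
  eq. (2.109); Biot–Savart law (2.94). [MajdaBertozziCUP2002]
* S. Friedlander, M. Vishik, Phys. Rev. Lett. 66 (1991) 2204–2206. [FriedlanderVishik1991]
* M. Vishik, J. Math. Pures Appl. (9) 75 (1996) 531–557. [Vishik1996]
* R. Shvydkoy, Comm. Math. Phys. 265 (2006) 507–545. [Shvydkoy2006]
* D. Henry, LNM 840 (1981), §7.2 (period map of a periodic linear evolution equation). [Henry1981]
-/

noncomputable section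

open MeasureTheory Set Function Filter Topology TopologicalSpace
open scoped NNReal ENNReal InnerProductSpace RealInnerProductSpace Laplacian

namespace Literature.Analysis.FluidPDE

/-- Local notation for physical space `ℝ³ = EuclideanSpace ℝ (Fin 3)`. -/
local notation "ℝ³" => EuclideanSpace ℝ (Fin 3)

/-! ### The inviscid linearised vorticity equation in semi-weak form -/

/-- The right-hand side of the **inviscid linearised vorticity equation** paired with a test field
`φ`: for `∂_σ ω = curl (W × ω) + curl (BS[ω] × Ω)` — the linearisation at `(W, Ω)` of the vorticity
form `∂ₜω = curl (v × ω)`, `v = BS[ω]`, of the Euler equations (Majda–Bertozzi, Prop. 2.21,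
eq. (2.109) with `ν = 0`) — one has, formally,
`d/dσ ∫ ω·φ = ∫ ⟪W × ω, curl φ⟫ + ∫ ⟪BS[ω] × Ω, curl φ⟫` (`∫ curl F · φ = ∫ F · curl φ`). Lebesgue pairings; `biotSavart` is the accepted Biot–Savart law. This
is `linVorticityPairing` without its Ornstein–Uhlenbeck integral
(`linVorticityPairing_eq_add_eulerVorticityPairing`). [folklore] -/
def eulerVorticityPairing (W Ω ω φ : ℝ³ → ℝ³) : ℝ :=
  (∫ y, ⟪cross (W y) (ω y), curl φ y⟫) + ∫ y, ⟪cross (biotSavart ω y) (Ω y), curl φ y⟫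

/-- **The `ε = 1` pairing is the Ornstein–Uhlenbeck pairing plus the inviscid pairing**:
`linVorticityPairing U Ω ω φ = ∫ ⟪ω, Δφ + ½ Dφ[y] + ½ φ⟫ + eulerVorticityPairing U Ω ω φ`
(definitional, up to reassociation). [folklore] -/
theorem linVorticityPairing_eq_add_eulerVorticityPairing (U Ω ω φ : ℝ³ → ℝ³) :
    linVorticityPairing U Ω ω φ =
      (∫ y, ⟪ω y, (Δ φ) y + (1 / 2 : ℝ) • fderiv ℝ φ y y + (1 / 2 : ℝ) • φ y⟫) +
        eulerVorticityPairing U Ω ω φ :=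
  add_assoc _ _ _

/-- The inviscid pairing vanishes for the zero perturbation. [folklore] -/
@[simp]
theorem eulerVorticityPairing_zero (W Ω φ : ℝ³ → ℝ³) : eulerVorticityPairing W Ω 0 φ = 0 := by
  simp [eulerVorticityPairing, cross, biotSavart]

/-- The inviscid pairing vanishes identically at the zero background `(W, Ω) = (0, 0)` (the
linearised equation is `∂_σ ω = 0`). [folklore] -/
@[simp]
theorem eulerVorticityPairing_zero_background (ω φ : ℝ³ → ℝ³) :
    eulerVorticityPairing 0 0 ω φ = 0 := by
  simp [eulerVorticityPairing, cross]

/-- The inviscid pairing is homogeneous in the perturbation. [folklore] -/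
theorem eulerVorticityPairing_smul (W Ω : ℝ³ → ℝ³) (c : ℝ) (ω φ : ℝ³ → ℝ³) :
    eulerVorticityPairing W Ω (c • ω) φ = c * eulerVorticityPairing W Ω ω φ := by
  simp only [eulerVorticityPairing, biotSavart_smul, Pi.smul_apply, cross_smul_left, cross_smul_right,
    real_inner_smul_left, integral_const_mul]
  ring

/-- **Weak solutions of the inviscid linearised vorticity equation** about the background `(W, Ω)`
on the `σ`-interval `[a, b]` — the `ε = 0` twin of the accepted `IsLinearisedVorticitySolution`, with
the same clauses: `ω` is jointly continuous, its slices lie in `L²(dy)` uniformly on `[a, b]` and are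
weakly divergence free, the Biot–Savart integrals `BS[ω(σ)](x)` converge absolutely to a locally
integrable field, and for every test field `φ ∈ C_c^∞(ℝ³; ℝ³)` the pairing `σ ↦ ∫ ω(σ)·φ` is
differentiable on `(a, b)` with derivative `eulerVorticityPairing (W σ) (Ω σ) (ω σ) φ` (its
continuity on `[a, b]` follows from the joint continuity, `continuous_pairing`). The class on which
an Euler monodromy must reproduce the dynamics (`IsEulerMonodromyAt`); it contains the classical
solutions from `C_c^∞` solenoidal data. [folklore] -/
structure IsLinearisedEulerVorticitySolution (W Ω : ℝ → ℝ³ → ℝ³) (a b : ℝ) (ω : ℝ → ℝ³ → ℝ³) :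
    Prop where
  /-- Joint continuity in `(σ, y)`. -/
  continuous : Continuous (uncurry ω)
  /-- Slices in `L²(dy)`. -/
  memLp : ∀ s ∈ Icc a b, MemLp (ω s) 2 volume
  /-- Uniformly on `[a, b]`. -/
  eLpNorm_le : ∃ C : ℝ≥0, ∀ s ∈ Icc a b, eLpNorm (ω s) 2 volume ≤ C
  /-- Slices are weakly divergence free. -/
  isWeaklyDivFree : ∀ s ∈ Icc a b, IsWeaklyDivFree (ω s)
  /-- The Biot–Savart integrals converge absolutely (true for continuous `L²` slices; recorded). -/
  integrable_kernel : ∀ s ∈ Icc a b, ∀ x : ℝ³,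
    Integrable (fun y => biotSavartKernel (x - y) (ω s y)) volume
  /-- The Biot–Savart velocities are locally integrable (recorded so that every pairing in
  `eulerVorticityPairing` is an honest integral). -/
  locallyIntegrable_biotSavart : ∀ s ∈ Icc a b, LocallyIntegrable (biotSavart (ω s)) volume
  /-- The inviscid equation, paired with time-independent test fields, on the open interval. -/
  hasDerivAt : ∀ φ : ℝ³ → ℝ³, FunctionSpaces.IsTestFunctionOn (⊤ : Opens ℝ³) φ →
    ∀ s ∈ Ioo a b,
      HasDerivAt (fun σ => ∫ y, ⟪ω σ y, φ y⟫) (eulerVorticityPairing (W s) (Ω s) (ω s) φ) s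

namespace IsLinearisedEulerVorticitySolution

variable {W Ω : ℝ → ℝ³ → ℝ³} {a b : ℝ} {ω : ℝ → ℝ³ → ℝ³}

/-- The zero perturbation solves the inviscid linearised equation about any background. [folklore] -/
protected theorem zero (W Ω : ℝ → ℝ³ → ℝ³) (a b : ℝ) :
    IsLinearisedEulerVorticitySolution W Ω a b 0 where
  continuous := continuous_const
  memLp _ _ := by simp
  eLpNorm_le := ⟨0, fun s _ => by simp⟩
  isWeaklyDivFree _ _ θ _ := by simp
  integrable_kernel _ _ x := by simp
  locallyIntegrable_biotSavart _ _ := by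
    rw [Pi.zero_apply, biotSavart_zero]
    exact locallyIntegrable_const (0 : ℝ³)
  hasDerivAt φ _ s _ := by
    simpa using hasDerivAt_const s (0 : ℝ)

/-- **The solution class is a cone**: scalar multiples of weak solutions are weak solutions (all
clauses are homogeneous; consistent with the linearity of a monodromy). [folklore] -/
theorem smul (h : IsLinearisedEulerVorticitySolution W Ω a b ω) (c : ℝ) :
    IsLinearisedEulerVorticitySolution W Ω a b (c • ω) := by
  have e : ∀ s, (c • ω) s = c • ω s := fun _ => rfl
  have e' : ∀ s y, (c • ω) s y = c • ω s y := fun _ _ => rfl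
  have eu : uncurry (c • ω) = fun p => c • uncurry ω p := rfl
  refine ⟨?_, fun s hs => ?_, ?_, fun s hs θ hθ => ?_, fun s hs x => ?_, fun s hs => ?_,
    fun φ hφ s hs => ?_⟩
  · rw [eu]
    exact h.continuous.const_smul c
  · rw [e]
    exact (h.memLp s hs).const_smul c
  · obtain ⟨C, hC⟩ := h.eLpNorm_le
    refine ⟨‖c‖₊ * C, fun s hs => ?_⟩
    rw [e]
    calc eLpNorm (c • ω s) 2 volume ≤ ‖c‖ₑ * eLpNorm (ω s) 2 volume := eLpNorm_const_smul_le
      _ ≤ ‖c‖ₑ * C := by gcongr; exact hC s hs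
      _ = ((‖c‖₊ * C : ℝ≥0) : ℝ≥0∞) := by rw [ENNReal.coe_mul, enorm_eq_nnnorm]
  · have h0 := h.isWeaklyDivFree s hs θ hθ
    simp only [e', real_inner_smul_left, integral_const_mul, h0, mul_zero]
  · simp only [e', biotSavartKernel_smul]
    exact (h.integrable_kernel s hs x).smul c
  · rw [e, biotSavart_smul]
    exact (h.locallyIntegrable_biotSavart s hs).smul c
  · have key := (h.hasDerivAt φ hφ s hs).const_mul c
    have e1 : (fun σ => ∫ y, ⟪(c • ω) σ y, φ y⟫) = fun σ => c * ∫ y, ⟪ω σ y, φ y⟫ := by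
      funext σ
      simp only [e', real_inner_smul_left, integral_const_mul]
    rw [e1, e, eulerVorticityPairing_smul]
    exact key

/-- Every slice of a solution is continuous. [folklore] -/
theorem continuous_slice (h : IsLinearisedEulerVorticitySolution W Ω a b ω) (s : ℝ) :
    Continuous (ω s) :=
  h.continuous.uncurry_left s

/-- **The pairings are continuous in `σ`** (on all of `ℝ`, in particular on `[a, b]`): joint
continuity of `ω` and compact support of the test field (Mathlib
`continuous_parametric_integral_of_continuous`). Together with `hasDerivAt` on `(a, b)` this
determines `∫ ω(b)·φ` from `∫ ω(a)·φ`, which is why no endpoint clause is needed. [folklore] -/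
theorem continuous_pairing (h : IsLinearisedEulerVorticitySolution W Ω a b ω) {φ : ℝ³ → ℝ³}
    (hφ : FunctionSpaces.IsTestFunctionOn (⊤ : Opens ℝ³) φ) :
    Continuous fun σ => ∫ y, ⟪ω σ y, φ y⟫ := by
  have heq : (fun σ => ∫ y, ⟪ω σ y, φ y⟫) = fun σ => ∫ y in tsupport φ, ⟪ω σ y, φ y⟫ := by
    funext σ
    refine (setIntegral_eq_integral_of_forall_compl_eq_zero fun y hy => ?_).symm
    rw [image_eq_zero_of_notMem_tsupport hy, inner_zero_right]
  rw [heq]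
  exact continuous_parametric_integral_of_continuous (f := fun σ y => ⟪ω σ y, φ y⟫)
    (h.continuous.inner (hφ.contDiff.continuous.comp continuous_snd)) hφ.hasCompactSupport

/-- **Slices do not move while the pairings are stationary**: if `d/dσ ∫ ω(σ)·φ = 0` on `(a, b)`
for every test field (i.e. the inviscid pairing vanishes along the solution), then `ω(b) = ω(a)`
a.e. (`a ≤ b`; mean value theorem for the continuous pairings, then du Bois-Reymond for vector
fields, `FunctionSpaces.ae_eq_of_forall_integral_inner_test_eq`). [folklore] -/
theorem ae_eq_of_forall_pairing_eq_zero (h : IsLinearisedEulerVorticitySolution W Ω a b ω)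
    (hab : a ≤ b)
    (h0 : ∀ φ : ℝ³ → ℝ³, FunctionSpaces.IsTestFunctionOn (⊤ : Opens ℝ³) φ →
      ∀ s ∈ Ioo a b, eulerVorticityPairing (W s) (Ω s) (ω s) φ = 0) :
    ω b =ᵐ[volume] ω a := by
  refine FunctionSpaces.ae_eq_of_forall_integral_inner_test_eq
    (h.continuous_slice b).locallyIntegrable (h.continuous_slice a).locallyIntegrable fun φ hφ => ?_
  rcases hab.eq_or_lt with rfl | hlt
  · rfl
  · have hderiv : ∀ s ∈ Ioo a b,
        HasDerivAt (fun σ => ∫ y, ⟪ω σ y, φ y⟫) ((fun _ => (0 : ℝ)) s) s := by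
      intro s hs
      simpa [h0 φ hφ s hs] using h.hasDerivAt φ hφ s hs
    obtain ⟨c, -, hc⟩ := exists_hasDerivAt_eq_slope (fun σ => ∫ y, ⟪ω σ y, φ y⟫)
      (fun _ => (0 : ℝ)) hlt (h.continuous_pairing hφ).continuousOn hderiv
    have hba : b - a ≠ 0 := (sub_pos.2 hlt).ne'
    rw [eq_comm, div_eq_zero_iff, sub_eq_zero] at hc
    exact hc.resolve_right hba

/-- **At the zero background the slices do not move**: a solution of the inviscid equation
linearised at `(0, 0)` on `[a, b]` (`a ≤ b`) — i.e. of `∂_σ ω = 0` in semi-weak form — has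
`ω(b) = ω(a)` a.e. [folklore] -/
theorem ae_eq_of_zero (h : IsLinearisedEulerVorticitySolution 0 0 a b ω) (hab : a ≤ b) :
    ω b =ᵐ[volume] ω a :=
  h.ae_eq_of_forall_pairing_eq_zero hab fun φ _ s _ => by simp

end IsLinearisedEulerVorticitySolution

/-! ### The Euler monodromy as data -/

/-- **Euler monodromy at a seed (interface).** For a flow `W : ℝ → ℝ³ → ℝ³` (time first), a period
`P` and a linear isometry `Q`, `M` is a bounded operator on `L²(w dy; ℝ³)` which (i) maps the
solenoidal space `X_w = divFreeL2 w` into itself and vanishes on `X_wᗮ`, and (ii) **propagates over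
`[0, P]`, twisted by `Q`**, every weak solution `ω` (class `IsLinearisedEulerVorticitySolution`) of
the Euler equations in vorticity form linearised at `(W, curl W)`,
`∂_σ ω = curl (W × ω) + curl (BS[ω] × curl W)`, whose initial slice defines an element of `X_w`:
`M [ω(0)] = [π̃(Q⁻¹) ω(P)]` (`pseudovectorPush`). This is the linear period map of the variational
equation (Kielhöfer 2012, §I.12) composed with the symmetry `Q`, the right object for seeds
`P`-periodic modulo `Q`, `W (σ + P) (Q y) = Q (W σ y)`; it is VERBATIM the accepted
`IsLinearisedMonodromyAt` with the inviscid solution class — the `ε = 0` end of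
`IsRescaledEulerLerayMonodromyW`. Existence/uniqueness of such an `M` is NOT asserted (see the module
docstring for what else is not). [cite: Kielhofer2012, §I.12 pp. 82–83 (period map, Floquet multipliers)] -/
structure IsEulerMonodromyAt (w : ℝ³ → ℝ≥0) (W : ℝ → ℝ³ → ℝ³) (P : ℝ) (Q : ℝ³ ≃ₗᵢ[ℝ] ℝ³)
    (M : Lp ℝ³ 2 (weightedMeasure w) →L[ℝ] Lp ℝ³ 2 (weightedMeasure w)) : Prop where
  /-- `M` maps the solenoidal space into itself. -/
  mapsTo : ∀ f ∈ divFreeL2 w, M f ∈ divFreeL2 w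
  /-- Normalisation: `M` vanishes on the orthogonal complement of the solenoidal space. -/
  eq_zero : ∀ f ∈ (divFreeL2 w)ᗮ, M f = 0
  /-- `M` reproduces every weak solution of the Euler equations linearised at `(W, curl W)` over
  `[0, P]`, twisted by the pseudovector action of `Q⁻¹`. -/
  propagates : ∀ ω : ℝ → ℝ³ → ℝ³,
    IsLinearisedEulerVorticitySolution W (fun s => curl (W s)) 0 P ω →
      ∀ (h₀ : MemLp (ω 0) 2 (weightedMeasure w))
        (h₁ : MemLp (pseudovectorPush Q.symm (ω P)) 2 (weightedMeasure w)),
        h₀.toLp _ ∈ divFreeL2 w → M (h₀.toLp _) = h₁.toLp _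

namespace IsEulerMonodromyAt

variable {w : ℝ³ → ℝ≥0} {W : ℝ → ℝ³ → ℝ³} {P : ℝ} {Q : ℝ³ ≃ₗᵢ[ℝ] ℝ³}
variable {M₁ M₂ : Lp ℝ³ 2 (weightedMeasure w) →L[ℝ] Lp ℝ³ 2 (weightedMeasure w)}

/-- Two Euler monodromies agree on the initial class of any weak solution they both
propagate. [folklore] -/
theorem apply_eq_of_solution (h₁ : IsEulerMonodromyAt w W P Q M₁)
    (h₂ : IsEulerMonodromyAt w W P Q M₂) {ω : ℝ → ℝ³ → ℝ³}
    (hω : IsLinearisedEulerVorticitySolution W (fun s => curl (W s)) 0 P ω)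
    (h₀ : MemLp (ω 0) 2 (weightedMeasure w))
    (hP : MemLp (pseudovectorPush Q.symm (ω P)) 2 (weightedMeasure w))
    (hx : h₀.toLp _ ∈ divFreeL2 w) : M₁ (h₀.toLp _) = M₂ (h₀.toLp _) := by
  rw [h₁.propagates ω hω h₀ hP hx, h₂.propagates ω hω h₀ hP hx]

/-- An Euler monodromy is determined by its values on the solenoidal space. [folklore] -/
theorem eq_of_eqOn_divFreeL2 (h₁ : IsEulerMonodromyAt w W P Q M₁)
    (h₂ : IsEulerMonodromyAt w W P Q M₂)
    (h : Set.EqOn M₁ M₂ (divFreeL2 w : Set (Lp ℝ³ 2 (weightedMeasure w)))) : M₁ = M₂ := by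
  ext1 f
  obtain ⟨x, hx, p, hp, rfl⟩ := IsLinearisedMonodromyAt.exists_add_mem_divFreeL2 f
  rw [map_add, map_add, h₁.eq_zero p hp, h₂.eq_zero p hp, h hx]

/-- **Uniqueness of the Euler monodromy from density of solvable data.** Let `D ⊆ L²(w dy)` be a
set of classes each of which is the initial class of some inviscid weak solution on `[0, P]` (with
final twisted slice in `L²(w dy)`) and lies in `X_w`, and suppose the span of `D` is dense in
`X_w`. Then any two Euler monodromies coincide: they agree on `D` (`apply_eq_of_solution`), hence
on its span (linearity) and on the closure (continuity), hence on `X_w`, and both vanish on `X_wᗮ`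
— the dischargeable form of "the period map is determined by the dynamics" (Kielhöfer 2012, §I.12:
`y(t) = U(t) y₀`). [cite: Kielhofer2012, §I.12 pp. 82–83 (period map, Floquet multipliers)] -/
theorem unique_of_dense (h₁ : IsEulerMonodromyAt w W P Q M₁) (h₂ : IsEulerMonodromyAt w W P Q M₂)
    {D : Set (Lp ℝ³ 2 (weightedMeasure w))}
    (hD : ∀ f ∈ D, ∃ (ω : ℝ → ℝ³ → ℝ³) (h₀ : MemLp (ω 0) 2 (weightedMeasure w)),
      IsLinearisedEulerVorticitySolution W (fun s => curl (W s)) 0 P ω ∧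
        MemLp (pseudovectorPush Q.symm (ω P)) 2 (weightedMeasure w) ∧
        h₀.toLp _ = f ∧ f ∈ divFreeL2 w)
    (hdense : (divFreeL2 w : Set (Lp ℝ³ 2 (weightedMeasure w))) ⊆
      closure (Submodule.span ℝ D : Set (Lp ℝ³ 2 (weightedMeasure w)))) :
    M₁ = M₂ := by
  -- agreement on `D`
  have hDeq : Set.EqOn M₁ M₂ D := by
    intro f hf
    obtain ⟨ω, h₀, hω, hP, hf0, hx⟩ := hD f hf
    subst hf0
    exact apply_eq_of_solution h₁ h₂ hω h₀ hP hx
  -- agreement on the span, by linearity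
  have hspan : Set.EqOn M₁ M₂ (Submodule.span ℝ D : Set (Lp ℝ³ 2 (weightedMeasure w))) := by
    intro f hf
    induction hf using Submodule.span_induction with
    | mem x hx => exact hDeq hx
    | zero => simp
    | add x y _ _ hx hy => rw [map_add, map_add, hx, hy]
    | smul a x _ hx => rw [map_smul, map_smul, hx]
  -- agreement on the closure, by continuity
  have hclos : Set.EqOn M₁ M₂
      (closure (Submodule.span ℝ D : Set (Lp ℝ³ 2 (weightedMeasure w)))) :=
    hspan.closure M₁.continuous M₂.continuous
  exact eq_of_eqOn_divFreeL2 h₁ h₂ fun f hf => hclos (hdense hf)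

/-- The zero operator is an Euler monodromy as soon as every weak solution it must reproduce has
(twisted) final class `0` — in particular vacuously; the trivial model of the interface. [folklore] -/
theorem zero_of_forall (h : ∀ ω : ℝ → ℝ³ → ℝ³,
      IsLinearisedEulerVorticitySolution W (fun s => curl (W s)) 0 P ω →
        ∀ (h₁ : MemLp (pseudovectorPush Q.symm (ω P)) 2 (weightedMeasure w)), h₁.toLp _ = 0) :
    IsEulerMonodromyAt w W P Q 0 where
  mapsTo _ _ := by simp
  eq_zero _ _ := rfl
  propagates ω hω h₀ h₁ _ := by rw [h ω hω h₁]; rfl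

end IsEulerMonodromyAt

/-! ### Non-vacuity: the zero seed -/

/-- `X_w` is closed in the Hilbert space `L²(w dy)`, hence complete, hence it admits the orthogonal
projection (Mathlib `Submodule.HasOrthogonalProjection.ofCompleteSpace`); this makes
`(divFreeL2 w).starProjection : L²(w dy) →L L²(w dy)` available. [folklore] -/
instance divFreeL2.hasOrthogonalProjection (w : ℝ³ → ℝ≥0) : (divFreeL2 w).HasOrthogonalProjection :=
  haveI : CompleteSpace (divFreeL2 w) := (isClosed_divFreeL2 w).completeSpace_coe
  inferInstance

/-- The weighted measure is absolutely continuous with respect to Lebesgue measure. [folklore] -/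
theorem weightedMeasure_absolutelyContinuous (w : ℝ³ → ℝ≥0) : weightedMeasure w ≪ volume :=
  withDensity_absolutelyContinuous _ _

/-- **The zero seed has the identity as Euler monodromy (non-vacuity of the interface).** At
`W = 0` the linearised equation is `∂_σ ω = 0` (`curl 0 = 0`, `eulerVorticityPairing 0 0 = 0`), so
every inviscid weak solution on `[0, P]`, `0 ≤ P`, satisfies `ω(P) = ω(0)` a.e.
(`IsLinearisedEulerVorticitySolution.ae_eq_of_zero`); hence for every weight `w` the orthogonal
projection onto `X_w` — the identity on `X_w`, zero on `X_wᗮ` — is an Euler monodromy at the zero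
seed with the trivial twist. [folklore] -/
theorem isEulerMonodromyAt_zero_starProjection (w : ℝ³ → ℝ≥0) {P : ℝ} (hP : 0 ≤ P) :
    IsEulerMonodromyAt w 0 P (LinearIsometryEquiv.refl ℝ ℝ³) (divFreeL2 w).starProjection where
  mapsTo f _ := Submodule.starProjection_apply_mem _ f
  eq_zero _ hf := (Submodule.starProjection_apply_eq_zero_iff _).2 hf
  propagates ω hω h₀ h₁ hx := by
    rw [Submodule.starProjection_eq_self_iff.2 hx]
    refine (MemLp.toLp_eq_toLp_iff h₀ h₁).2 ?_
    have hcurl : (fun s => curl ((0 : ℝ → ℝ³ → ℝ³) s)) = 0 := by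
      funext s y
      ext i
      fin_cases i <;> simp [curl]
    rw [hcurl] at hω
    have hpush : pseudovectorPush (LinearIsometryEquiv.refl ℝ ℝ³).symm (ω P) = ω P := by
      rw [show (LinearIsometryEquiv.refl ℝ ℝ³).symm = LinearIsometryEquiv.refl ℝ ℝ³ from rfl,
        pseudovectorPush_refl]
    rw [hpush]
    exact (weightedMeasure_absolutelyContinuous w).ae_eq (hω.ae_eq_of_zero hP).symm

/-! ### The requested short name: the solenoidal vorticity space `L²_σ(ℝ³, dy)` (`w = 1`) -/

section Flat

variable (W : ℝ → ℝ³ → ℝ³) (P : ℝ) (Q : ℝ³ ≃ₗᵢ[ℝ] ℝ³)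

/-- **`IsEulerMonodromy W P Q M`** — the Euler monodromy interface in the solenoidal vorticity space
`X = L²_σ(ℝ³, dy)` (flat weight `w = 1`: `weightedMeasure_one`, `mem_divFreeL2_one_iff`), the space
of the repaired crux #3; any other weight is `IsEulerMonodromyAt w`. [cite: Kielhofer2012, §I.12 pp. 82–83 (period map, Floquet multipliers)] -/
abbrev IsEulerMonodromy
    (M : Lp ℝ³ 2 (weightedMeasure (1 : ℝ³ → ℝ≥0)) →L[ℝ]
      Lp ℝ³ 2 (weightedMeasure (1 : ℝ³ → ℝ≥0))) : Prop :=
  IsEulerMonodromyAt 1 W P Q M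

/-- Unfolding the short name (definitional). [folklore] -/
theorem isEulerMonodromy_iff
    (M : Lp ℝ³ 2 (weightedMeasure (1 : ℝ³ → ℝ≥0)) →L[ℝ]
      Lp ℝ³ 2 (weightedMeasure (1 : ℝ³ → ℝ≥0))) :
    IsEulerMonodromy W P Q M ↔ IsEulerMonodromyAt 1 W P Q M :=
  Iff.rfl

variable {P}

/-- Non-vacuity of the short name: at the zero seed, for `0 ≤ P` and the trivial twist, the
orthogonal projection onto `L²_σ(ℝ³, dy)` is an Euler monodromy. [folklore] -/
theorem isEulerMonodromy_zero_starProjection (hP : 0 ≤ P) :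
    IsEulerMonodromy 0 P (LinearIsometryEquiv.refl ℝ ℝ³)
      (divFreeL2 (1 : ℝ³ → ℝ≥0)).starProjection :=
  isEulerMonodromyAt_zero_starProjection 1 hP

end Flat

end Literature.Analysis.FluidPDE

end
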